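import Mathlib
import Summits.ResolutionOfSingularities.ResolutionOfSingularities.Theorems.RadicialJungCleanModelsContactDropBlowup
import HarnessLib

/-!
# Route `RadicialJung`, crux `CleanModels` (stmt-ResolutionOfSingularities-15917), line `Sketch` rev 20, stub 4e
# `stub_cleanPrincipalization3`: toward L7b — PHASE 1 ALONG A CHAIN OF POINT BLOWING UPS (the contact is used up one unit per step)

Memo `Cruxes/CleanModels/Lines/Sketch-memo-4e-cleanPermissible.md` rev 11.3 §2.3 `(μ,1)` (a) / rev 10 §3 / §4.1 (O8).  A CHAIN OF POINT BLOWING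
UPS FOLLOWING A CURVE (`IsPointChainAlong σ C₀ C x n`): `X₀ ← X₁ ← ⋯ ← X_n`, each step the blowing up (`IsBlowup`, universal property) of the
closed point of the current strict transform of the curve through which the chain passes, the next point taken on the new strict transform over
it.  Along such a chain of length `n ≤ k` starting at a point `x₀ = σ(x)` of a regular curve `C₀` on a regular locally Noetherian `X₀` with
`dim 𝒪_{X₀,x₀} = 3`, a surface `V(s)` in contact normal form `s = γ w^k + s₀` (`γ` unit, `s₀ ∈ 𝓘_{C₀,x₀}`, `(𝓘_{C₀,x₀}, w) = 𝔪`) pulls back to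
`σ^#(s) = c · e^n · (γ_n e^{k−n} + π_n)` with `c, γ_n` units, `π_n ∈ 𝓘_{C_n,x}`, `(𝓘_{C_n,x}, e) = 𝔪_x`, and `σ^#(w) = ω·e` (`ω` a unit): the
exceptional coordinate `e` at `x` is transversal to the curve and the residual contact is `k − n` — by induction on the chain from the one-step
theorems ✓ p690623/p691104 (`contact_drop_of_isBlowup_point`, `strictTransform_curve_data_of_isBlowup_point`).  At `n = k` the residual factor is
a unit (`isUnit_contact_drop_one`, ✓ p690181): the strict transform of `V(s)` has left the curve, which is L7b phase 1 (memo rev 10 §3) up to the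
final `cleanPermissibleAt_of_split` (✓ p685976) at a charged landing.
* `IsPointChainAlong` (inductive), `contact_along_pointChain`.

Honest framing: OURS; nothing here proves resolution in characteristic `p` or any case of `CleanModels`; existence of the chain (`exists_isBlowup`)
and the clean bookkeeping are not done here.
-/

noncomputable section

set_option linter.dupNamespace false -- mandated namespace of this single-conjunct summit

open CategoryTheory AlgebraicGeometry TopologicalSpace IsLocalRing
open Literature.AlgebraicGeometry.Resolution
open Scheme.IdealSheafData

universe u

namespace Summit.ResolutionOfSingularities.ResolutionOfSingularities.Theorems.RadicialJung.CleanModels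

/-- **A chain of point blowing ups following a curve.**  `IsPointChainAlong σ C₀ C x n`: `σ : X → X₀` is a composite of `n` blowing ups, each at
the CLOSED point (with regular point subscheme) of the current strict transform of the curve `C₀` through which the chain passes, `C` is the
`n`-th iterated strict transform `cl(τ⁻¹(C ∖ {pt}))` and `x ∈ X` the current point of the chain (a point of `C` over the previous one); the chain
starts at `σ x ∈ C₀`.  All intermediate schemes are locally Noetherian (recorded as instance arguments of `cons`). [folklore] -/
inductive IsPointChainAlong : ∀ {X₀ X : Scheme.{u}} (_ : X ⟶ X₀) (_ : Closeds X₀) (_ : Closeds X) (_ : X), ℕ → Prop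
  /-- the empty chain at a point `x₀` -/
  | nil {X₀ : Scheme.{u}} (C₀ : Closeds X₀) (x₀ : X₀) : IsPointChainAlong (𝟙 X₀) C₀ C₀ x₀ 0
  /-- one more blowing up, at the current point `τ x'` of the chain, and a point `x'` of the new strict transform over it -/
  | cons {X₀ X X' : Scheme.{u}} [IsLocallyNoetherian X] [IsLocallyNoetherian X'] (σ : X ⟶ X₀) (C₀ : Closeds X₀) (C : Closeds X)
      (n : ℕ) (τ : X' ⟶ X) (x' : X') (hx : IsClosed ({τ x'} : Set X)) :
      IsPointChainAlong σ C₀ C (τ x') n →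
      Scheme.IsRegular (vanishingIdeal (⟨{τ x'}, hx⟩ : Closeds X)).subscheme →
      IsBlowup τ (vanishingIdeal (⟨{τ x'}, hx⟩ : Closeds X)) →
      x' ∈ closure (τ ⁻¹' ((C : Set X) \ {τ x'})) →
      IsPointChainAlong (τ ≫ σ) C₀ ⟨closure (τ ⁻¹' ((C : Set X) \ {τ x'})), isClosed_closure⟩ x' (n + 1)

/-- **L7b phase 1 along a chain: the contact is used up one unit per step.**  See the module docstring.  Conclusions at the end point `x` of a
chain of length `n ≤ k`: `X` is regular, `C` is a regular curve at each of its points, `x ∈ C`, `dim 𝒪_{X,x} = 3`, and there are `e, c, ω, γ', π'`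
with `(𝓘_{C,x}, e) = 𝔪_x`, `c, ω, γ'` units, `π' ∈ 𝓘_{C,x}`, `σ^#(w) = ω·e` and `σ^#(γ w^k + s₀) = c · e^n · (γ' e^{k−n} + π')`.
[cite: CossartJannsenSaito2020, proof of Thm. 6.28, Step 5] [cite: CossartPiltant2008, Prop. 4.4 (proof, p. 10)] -/
theorem contact_along_pointChain {X₀ X : Scheme.{u}} {σ : X ⟶ X₀} {C₀ : Closeds X₀} {C : Closeds X} {x : X} {n : ℕ}
    (h : IsPointChainAlong σ C₀ C x n) [IsLocallyNoetherian X₀] [IsLocallyNoetherian X] (hX₀ : Scheme.IsRegular X₀)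
    (hC₀reg : ∀ y ∈ (C₀ : Set X₀), ∃ c : Fin 2 → X₀.presheaf.stalk y,
      IsRsopPart c ∧ Ideal.span (Set.range c) = stalkIdeal (vanishingIdeal C₀) y)
    (hxC₀ : σ x ∈ (C₀ : Set X₀)) (hdim₀ : ringKrullDim (X₀.presheaf.stalk (σ x)) = 3)
    (w γ s₀ : X₀.presheaf.stalk (σ x)) (hw : stalkIdeal (vanishingIdeal C₀) (σ x) ⊔ Ideal.span {w} = maximalIdeal _)
    (hγ : IsUnit γ) (hs₀ : s₀ ∈ stalkIdeal (vanishingIdeal C₀) (σ x)) (k : ℕ) (hnk : n ≤ k) :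
    Scheme.IsRegular X ∧
    (∀ y ∈ (C : Set X), ∃ c : Fin 2 → X.presheaf.stalk y, IsRsopPart c ∧ Ideal.span (Set.range c) = stalkIdeal (vanishingIdeal C) y) ∧
    x ∈ (C : Set X) ∧ ringKrullDim (X.presheaf.stalk x) = 3 ∧
    ∃ (e c ω γ' π' : X.presheaf.stalk x), stalkIdeal (vanishingIdeal C) x ⊔ Ideal.span {e} = maximalIdeal _ ∧
      IsUnit c ∧ IsUnit ω ∧ IsUnit γ' ∧ π' ∈ stalkIdeal (vanishingIdeal C) x ∧
      (σ.stalkMap x).hom w = ω * e ∧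
      (σ.stalkMap x).hom (γ * w ^ k + s₀) = c * e ^ n * (γ' * e ^ (k - n) + π') := by
  induction h with
  | nil C₀ x₀ =>
    refine ⟨hX₀, hC₀reg, hxC₀, hdim₀, w, 1, 1, γ, s₀, hw, isUnit_one, isUnit_one, hγ, hs₀, ?_, ?_⟩
    · rw [Scheme.Hom.stalkMap_id]
      simp only [one_mul]
      rfl
    · rw [Scheme.Hom.stalkMap_id]
      simp only [pow_zero, one_mul, Nat.sub_zero]
      rfl
  | cons σ C₀ C n τ x' hx hchain hYreg hτ hx' ih =>
    -- the induction hypothesis at the previous point `τ x'` (note `(τ ≫ σ) x' = σ (τ x')`)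
    obtain ⟨hX, hCreg, hxC, hdim, e, c, ω, γ', π', he, hc, hω, hγ', hπ', hwimg, hsimg⟩ :=
      ih hC₀reg hxC₀ hdim₀ w γ s₀ hw hγ hs₀ (Nat.le_of_succ_le hnk)
    -- the data reproduce themselves at `x'`
    obtain ⟨hX', hC'reg, hdim'⟩ := strictTransform_curve_data_of_isBlowup_point hX hx hYreg hτ hCreg hxC hdim hx'
    -- one step of the contact, with the previous exceptional coordinate `e` as the transversal coordinate
    have hk : 1 ≤ k - n := by omega
    obtain ⟨e', he', htr', γ₁, hγ₁, v₁, hv₁, π₁, hπ₁, h1, h2⟩ :=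
      contact_drop_of_isBlowup_point hX hx hYreg hτ hCreg hxC hdim hx' e γ' 1 π' he hγ' hπ' (k - n) hk 1 0
    -- `τ^#(e) = v₁ e'` from the monomial bookkeeping with `u = 1`, `A = 1`, `a = 0`
    have heimg : (τ.stalkMap x').hom e = v₁ * e' := by
      simpa using h2
    refine ⟨hX', hC'reg, hx', hdim', e', (τ.stalkMap x').hom c * v₁ ^ n, (τ.stalkMap x').hom ω * v₁, γ₁, π₁, htr',
      (hc.map _).mul (hv₁.pow n), (hω.map _).mul hv₁, hγ₁, hπ₁, ?_, ?_⟩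
    · rw [Scheme.Hom.stalkMap_comp]
      change (τ.stalkMap x').hom ((σ.stalkMap (τ x')).hom w) = _
      rw [hwimg, map_mul, heimg]
      ring
    · -- restate the induction hypothesis with the instances of the current stalk (same term up to unfolding)
      have hsimg' : (σ.stalkMap (τ x')).hom (γ * w ^ k + s₀) = c * e ^ n * (γ' * e ^ (k - n) + π') := hsimg
      rw [Scheme.Hom.stalkMap_comp]
      change (τ.stalkMap x').hom ((σ.stalkMap (τ x')).hom (γ * w ^ k + s₀)) = _
      rw [hsimg', map_mul, map_mul, map_pow, heimg, h1, show k - n - 1 = k - (n + 1) by omega]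
      ring

end Summit.ResolutionOfSingularities.ResolutionOfSingularities.Theorems.RadicialJung.CleanModels

end
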